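import Summits.QuantumFields.BalabanUV.T4Continuum.Support.LatticeWeitzenbock
import Summits.QuantumFields.BalabanUV.T4Continuum.Support.ColourCovariantLaplacian

/-!
# T⁴ programme, spine node NE2 (U1a) — THE WEITZENBÖCK BRIDGE: row B2's `covLapC` IS the rough Laplacian of `Support/LatticeWeitzenbock`
# for slot-independent transporters, so the Hodge form of the tier-B operator differs from row B2's by the lifted commutator blocks EXACTLY

Tenth generation of the NE2 prover lineage P1 of the cell `pub-balaban`, file 7 (on files `Support/LatticeWeitzenbock` p209345 and generation 9's
`Support/ColourCovariantLaplacian`).  `LatticeWeitzenbock.weitzenbock` is stated on 1-forms indexed `Fin d × S`; row B2's operators live on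
`(Tor × Fin d) × o` (site, component, colour).  For colour transporters that do NOT depend on the component slot (`R ν (x, κ) = Rb ν x` — the case of
a lattice gauge field, [Balaban1985BackgroundPropagators] (3.3)) this file transports the identity to row B2's index convention:
 * §1 the index equivalence `slotEquiv : (Tor × Fin d) × o ≃ Fin d × (Tor × o)`, `lift A = A.submatrix slotEquiv slotEquiv` (multiplicative, `ᴴ`-,
   sum-compatible), the block-diagonal embedding `blk`, the 0-form covariant differences **`D0 c Rb ν = c·(siteMul (Rb ν)·(shiftS ν ⊗ 1) − 1)`** on
   `Tor × o`, and `shiftM_eq`/entry lemmas;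
 * §2 **`covDc_eq_lift`**: `covDc c (slotLift Rb) ν = lift (blk (D0 c Rb ν))`; **`covLapC_eq_lift_rough`**: `covLapC c (slotLift Rb) = lift (roughOp (D0 c Rb))`;
 * §3 **`hodge_sub_covLapC`**: `lift (½•curlᴴcurl + divᴴdiv) − covLapC c (slotLift Rb) = lift (commOp (D0 c Rb))` and, with `commOp_affine`,
   `= (c·c̄) • lift (oneOp (ν, μ) ↦ [T_ν, T_μᴴ])`, `T_ν = siteMul (Rb ν)·(shiftS ν ⊗ 1)` — the holonomy-defect blocks (carried, after the dictionary's
   identification with plaquette fields, by `ShiftedZerothOrder.Smix`).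

HONEST FRAMING (T4-DAG p. 1).  Index bookkeeping + the exact identity of file 6; MODEL LEVEL (transporters `Rb` are DATA); it does NOT assert that
`½curlᴴcurl` is the Hessian (3.10) of the Wilson action (dictionary B0), nor supply `PerturbationLaws` for the commutator blocks as plaquette fields
(that needs the holonomy fields' `BoundedBackgroundM` data = NE3 + regularity, a future row B2.w); NE2 NOT PROVED; spine 0/9; NOT infinite volume
/ mass gap / Clay.  HONEST DEPENDENCY: continuum YM on T⁴ ⇐ BetaPertH ∧ nine spine estimates (0/9 proved); BetaPertH ⇐ (D1) ∧ (D4) ∧ CAP+tail;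
G-an2-4 gates asym, D1 and NE2/3/4.  ABSOLUTE RULE kept; no `sorry`.
-/

noncomputable section

open scoped BigOperators ComplexConjugate Matrix Kronecker

namespace Summit.QuantumFields.BalabanUV.T4Continuum.WeitzenbockBridge

open Literature.MathematicalPhysics.QuantumFieldTheory.Balaban1983to89.B5Prop11Plancherel (Tor shiftM fdiff unitVec)
open Literature.MathematicalPhysics.QuantumFieldTheory.Balaban1983to89.B5Action121 (shiftS)
open Summit.QuantumFields.BalabanUV.T4Continuum.BlockMultiplication
open Summit.QuantumFields.BalabanUV.T4Continuum.ColourCovariantLaplacian (covDc covLapC)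
open Summit.QuantumFields.BalabanUV.T4Continuum.LatticeWeitzenbock

variable {d : ℕ} (Nf : Fin d → ℕ) [hNf : ∀ μ, NeZero (Nf μ)] {o : Type*} [Fintype o] [DecidableEq o]

/-! ## §1 Index bookkeeping -/

/-- `((x, κ), a) ↦ (κ, (x, a))`. [folklore] -/
def slotEquiv : (Tor Nf × Fin d) × o ≃ Fin d × (Tor Nf × o) where
  toFun i := (i.1.2, (i.1.1, i.2))
  invFun j := ((j.2.1, j.1), j.2.2)
  left_inv := fun _ => rfl
  right_inv := fun _ => rfl

/-- transport of a `Fin d × (Tor × o)`-indexed operator to row B2's index convention. [folklore] -/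
def lift (A : Matrix (Fin d × (Tor Nf × o)) (Fin d × (Tor Nf × o)) ℂ) : Matrix ((Tor Nf × Fin d) × o) ((Tor Nf × Fin d) × o) ℂ :=
  A.submatrix (slotEquiv Nf) (slotEquiv Nf)

omit hNf [Fintype o] [DecidableEq o] in
/-- entries of `lift`. [folklore] -/
@[simp] theorem lift_apply (A : Matrix (Fin d × (Tor Nf × o)) (Fin d × (Tor Nf × o)) ℂ) (x y : Tor Nf) (κ κ' : Fin d) (a b : o) :
    lift Nf A ((x, κ), a) ((y, κ'), b) = A (κ, (x, a)) (κ', (y, b)) := rfl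

omit [DecidableEq o] in
/-- `lift` is multiplicative. [folklore] -/
theorem lift_mul (A B : Matrix (Fin d × (Tor Nf × o)) (Fin d × (Tor Nf × o)) ℂ) : lift Nf (A * B) = lift Nf A * lift Nf B := by
  rw [lift, lift, lift, Matrix.submatrix_mul_equiv]

omit hNf [Fintype o] [DecidableEq o] in
/-- `lift` commutes with `ᴴ`. [folklore] -/
theorem lift_conjTranspose (A : Matrix (Fin d × (Tor Nf × o)) (Fin d × (Tor Nf × o)) ℂ) : lift Nf Aᴴ = (lift Nf A)ᴴ := by
  rw [lift, lift, Matrix.conjTranspose_submatrix]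

omit hNf [Fintype o] [DecidableEq o] in
/-- `lift` is additive. [folklore] -/
theorem lift_add (A B : Matrix (Fin d × (Tor Nf × o)) (Fin d × (Tor Nf × o)) ℂ) : lift Nf (A + B) = lift Nf A + lift Nf B := rfl

omit hNf [Fintype o] [DecidableEq o] in
/-- `lift` respects subtraction. [folklore] -/
theorem lift_sub (A B : Matrix (Fin d × (Tor Nf × o)) (Fin d × (Tor Nf × o)) ℂ) : lift Nf (A - B) = lift Nf A - lift Nf B := rfl

omit hNf [Fintype o] [DecidableEq o] in
/-- `lift` respects scalars. [folklore] -/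
theorem lift_smul (c : ℂ) (A : Matrix (Fin d × (Tor Nf × o)) (Fin d × (Tor Nf × o)) ℂ) : lift Nf (c • A) = c • lift Nf A := rfl

omit hNf [Fintype o] [DecidableEq o] in
/-- `lift` respects finite sums. [folklore] -/
theorem lift_sum {σ : Type*} (s : Finset σ) (A : σ → Matrix (Fin d × (Tor Nf × o)) (Fin d × (Tor Nf × o)) ℂ) :
    lift Nf (∑ l ∈ s, A l) = ∑ l ∈ s, lift Nf (A l) := by
  ext i j
  simp only [lift, Matrix.submatrix_apply, Matrix.sum_apply]

/-- the block-diagonal embedding of a 0-form operator into 1-forms `Fin d × S`. [folklore] -/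
def blk {S : Type*} (X : Matrix S S ℂ) : Matrix (Fin d × S) (Fin d × S) ℂ := oneOp fun κ κ' => if κ = κ' then X else 0

omit [Fintype o] [DecidableEq o] in
/-- entries of `blk`. [folklore] -/
@[simp] theorem blk_apply {S : Type*} (X : Matrix S S ℂ) (κ κ' : Fin d) (s t : S) :
    blk (d := d) X (κ, s) (κ', t) = if κ = κ' then X s t else 0 := by
  simp only [blk, oneOp, Matrix.of_apply]; split_ifs <;> rfl

omit [Fintype o] [DecidableEq o] in
/-- `roughOp D = blk (Σ DᴴD)` (definitional). [folklore] -/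
theorem roughOp_eq_blk {S : Type*} [Fintype S] (D : Fin d → Matrix S S ℂ) : roughOp D = blk (∑ l, (D l)ᴴ * D l) := rfl

omit [DecidableEq o] in
/-- `blk` is multiplicative. [folklore] -/
theorem blk_mul {S : Type*} [Fintype S] [DecidableEq S] (X Y : Matrix S S ℂ) : blk (d := d) (X * Y) = blk X * blk Y := by
  ext ⟨κ, s⟩ ⟨κ', t⟩
  rw [Matrix.mul_apply, Fintype.sum_prod_type]
  simp only [blk_apply]
  rw [Finset.sum_eq_single κ]
  · by_cases h : κ = κ'
    · subst h; simp only [if_true, Matrix.mul_apply]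
    · simp only [h, if_true, if_false, mul_zero, Finset.sum_const_zero]
  · intro l _ hl; simp [Ne.symm hl]
  · intro hk; exact absurd (Finset.mem_univ κ) hk

omit [Fintype o] [DecidableEq o] in
/-- `blk` commutes with `ᴴ`. [folklore] -/
theorem blk_conjTranspose {S : Type*} (X : Matrix S S ℂ) : blk (d := d) Xᴴ = (blk X)ᴴ := by
  ext ⟨κ, s⟩ ⟨κ', t⟩
  simp only [blk_apply, Matrix.conjTranspose_apply]
  by_cases h : κ = κ'
  · subst h; simp
  · rw [if_neg h, if_neg (Ne.symm h), star_zero]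

omit [Fintype o] [DecidableEq o] in
/-- `blk` respects finite sums. [folklore] -/
theorem blk_sum {S σ : Type*} (s : Finset σ) (X : σ → Matrix S S ℂ) : blk (d := d) (∑ l ∈ s, X l) = ∑ l ∈ s, blk (X l) := by
  ext ⟨κ, u⟩ ⟨κ', t⟩
  simp only [blk_apply, Matrix.sum_apply]
  split_ifs <;> simp

/-- **THE 0-FORM COVARIANT DIFFERENCES** `D0 c Rb ν = c·(siteMul (Rb ν)·(shiftS ν ⊗ 1) − 1)` on `Tor × o` (transporters per site, NOT per slot).
[cite: Balaban1985BackgroundPropagators, (3.3) p.390 (shape)] [folklore] -/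
def D0 (c : ℂ) (Rb : Fin d → Tor Nf → Matrix o o ℂ) (ν : Fin d) : Matrix (Tor Nf × o) (Tor Nf × o) ℂ :=
  c • (siteMul (Rb ν) * shiftS Nf ν ⊗ₖ (1 : Matrix o o ℂ) - 1)

/-- slot-independent lift of site transporters to row B2's data type. [folklore] -/
def slotLift (Rb : Fin d → Tor Nf → Matrix o o ℂ) : Fin d → (Tor Nf × Fin d → Matrix o o ℂ) := fun ν i => Rb ν i.1

/-! ## §2 Row B2's operators are the lifted block operators -/

/-- **`covDc = lift (blk D0)`** for slot-independent transporters. [folklore] -/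
theorem covDc_eq_lift (c : ℂ) (Rb : Fin d → Tor Nf → Matrix o o ℂ) (ν : Fin d) :
    covDc Nf c (slotLift Nf Rb) ν = lift Nf (blk (D0 Nf c Rb ν)) := by
  ext ⟨⟨x, κ⟩, a⟩ ⟨⟨y, κ'⟩, b⟩
  rw [lift_apply, blk_apply, covDc, D0, Matrix.smul_apply, Matrix.sub_apply, siteMul_mul_kron_apply]
  simp only [slotLift, shiftM, Matrix.one_apply, Prod.mk.injEq, smul_eq_mul]
  by_cases h : κ = κ'
  · subst h
    rw [if_pos rfl, Matrix.smul_apply, Matrix.sub_apply, siteMul_mul_kron_apply]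
    simp only [shiftS, Matrix.one_apply, Prod.mk.injEq, smul_eq_mul, and_true]
  · rw [if_neg h]
    have h1 : ¬(y = x + unitVec Nf ν ∧ κ' = κ) := fun hh => h hh.2.symm
    have h2 : ¬((x = y ∧ κ = κ') ∧ a = b) := fun hh => h hh.1.2
    rw [if_neg h1, if_neg h2, mul_zero, sub_zero, mul_zero]

/-- **ROW B2's COVARIANT LAPLACIAN IS THE LIFTED ROUGH LAPLACIAN**: `covLapC c (slotLift Rb) = lift (roughOp (D0 c Rb))`. [folklore] -/
theorem covLapC_eq_lift_rough (c : ℂ) (Rb : Fin d → Tor Nf → Matrix o o ℂ) :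
    covLapC Nf c (slotLift Nf Rb) = lift Nf (roughOp (D0 Nf c Rb)) := by
  rw [covLapC, roughOp_eq_blk, blk_sum, lift_sum]
  refine Finset.sum_congr rfl fun ν _ => ?_
  rw [covDc_eq_lift, blk_mul, lift_mul, blk_conjTranspose, lift_conjTranspose]

/-! ## §3 The bridge: Hodge form − row B2's operator = lifted commutator blocks -/

/-- **THE WEITZENBÖCK BRIDGE**: `lift (½•curlᴴcurl + divᴴdiv) − covLapC c (slotLift Rb) = lift (commOp (D0 c Rb))` — the Hodge form of the covariant
1-form operator exceeds row B2's componentwise operator by the lifted commutator blocks, EXACTLY. [folklore] -/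
theorem hodge_sub_covLapC (c : ℂ) (Rb : Fin d → Tor Nf → Matrix o o ℂ) :
    lift Nf ((2 : ℂ)⁻¹ • ((curlOp (D0 Nf c Rb))ᴴ * curlOp (D0 Nf c Rb)) + (divOp (D0 Nf c Rb))ᴴ * divOp (D0 Nf c Rb))
      - covLapC Nf c (slotLift Nf Rb) = lift Nf (commOp (D0 Nf c Rb)) := by
  rw [weitzenbock, lift_add, covLapC_eq_lift_rough, add_sub_cancel_left]

/-- … and the commutator blocks are `c·c̄` times the HOLONOMY-DEFECT blocks `[T_ν, T_μᴴ]`, `T_ν = siteMul (Rb ν)·(shiftS ν ⊗ 1)`. [folklore] -/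
theorem hodge_sub_covLapC_eq_holonomy (c : ℂ) (Rb : Fin d → Tor Nf → Matrix o o ℂ) :
    lift Nf ((2 : ℂ)⁻¹ • ((curlOp (D0 Nf c Rb))ᴴ * curlOp (D0 Nf c Rb)) + (divOp (D0 Nf c Rb))ᴴ * divOp (D0 Nf c Rb))
      - covLapC Nf c (slotLift Nf Rb)
      = (c * star c) • lift Nf (oneOp fun ν μ =>
          (siteMul (Rb ν) * shiftS Nf ν ⊗ₖ (1 : Matrix o o ℂ)) * (siteMul (Rb μ) * shiftS Nf μ ⊗ₖ (1 : Matrix o o ℂ))ᴴ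
            - (siteMul (Rb μ) * shiftS Nf μ ⊗ₖ (1 : Matrix o o ℂ))ᴴ * (siteMul (Rb ν) * shiftS Nf ν ⊗ₖ (1 : Matrix o o ℂ))) := by
  rw [hodge_sub_covLapC]
  have h := commOp_affine c (fun ν => siteMul (Rb ν) * shiftS Nf ν ⊗ₖ (1 : Matrix o o ℂ))
  rw [show D0 Nf c Rb = fun ν => c • (siteMul (Rb ν) * shiftS Nf ν ⊗ₖ (1 : Matrix o o ℂ) - 1) from rfl, h, lift_smul]

end Summit.QuantumFields.BalabanUV.T4Continuum.WeitzenbockBridge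

end
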